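import Literature.Barriers.CriticalPhenomena.PlaquetteWalkHoleRootFrame
import HarnessLib

/-!
# Barrier catalogue (SAWScalingLimit): a cost-`5` wound class-`B2a` walk from a hole root ends on a SLANTED side — unconditionally
(«NO VERTICAL END»)

`Z → ∞` limit model of the printed Yang–Baxter weights [GlazmanManolescu2019, §1, eq. (1)]; the «RECTANGLE COEFFICIENT» line.
`PlaquetteWalkHoleRootFirstTurn.end_slanted_of_injective_cost_five` (#855) derived the slanted end from the absence of doubly visited
plaquettes; this file removes that hypothesis by a FRAME argument (exact census kit j276221: no vertical-end class-`B2a` member at level `5`):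

Suppose a wound class-`B2a` walk `ω` of limit cost `5` from the hole root `w.side W` returned to a VERTICAL side of `r`. Then
(`turn_profile_of_cost_five`) its isolated turns are exactly the two ends of the top run (row `Y`) and the two ends of the bottom run
(row `Y'`), none strictly between; the leftmost column `X` and the rightmost column `X'` each carry two isolated turns
(`two_left_turns`, `two_right_turns`), which are therefore the four CORNERS `(X,Y)`, `(X,Y')`, `(X',Y)`, `(X',Y')` of the frame: the
top run and the bottom run both span `[X, X']` (`top_run_shape`, `bottom_run_shape`). An extreme column is singly visited
(`left_single_visit`, `right_single_visit`), so a turn inside it strictly between the extreme rows would be an isolated middle turn: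
the walk runs STRAIGHT down (or up) an extreme column from corner to corner (`ΩG.column_descent`, `ΩG.column_ascent`). Chasing the
top run's exit corner down its column to the bottom run's entry, along the bottom run to its exit corner and up the other column
back to the top run's ENTRY arc closes the four runs into a cycle in the arc order — `j₀ < i₁ < j₀' < i₁' < j₀` — a contradiction.

* `ΩG.no_middle_isolated_turn_of_vertical_end`, `ΩG.column_descent`, `ΩG.column_ascent`, `ΩG.left_corners_of_vertical_end`,
  `ΩG.right_corners_of_vertical_end` (the frame of a vertical-end cost-`5` walk);
* ★★★ `ΩG.end_slanted_of_cost_five`: a wound class-`B2a` walk of limit cost `5` from the hole root ends on the `N` or the `S` side of `r`;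
* ★★ `ΩG.isolated_eq_five_of_cost_five`: hence `n_{u₁} + n_{u₂} = 5` and the end slot has degree `1`.

Use (venture lane «pcv-sawmu», b-engine-1 g25): with `PlaquetteWalkWoundExcursionTurning` every cost-`5` wound class-`B2a` walk has `5 + 2n_w`
turning arcs of which `≥ 4` lie in the excursion; this is the frame half of the structural statement (R2) of `PlaquetteWalkHoleRootRowLaw`.
[GlazmanManolescu2019 §1 Fig. 1, eq. (1), Lemma 2.1, Remark 2.2; Glazman 2015 Lemma 3.1 (proof, pp. 6–7)]
-/

noncomputable section

namespace Literature.Probability.RandomPlanarGeometry.SAW.YangBaxter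

open Real
open Literature.Barriers.CriticalPhenomena.PlaquetteWalk

open private fc_fh fc_ne fh_add_Mv three_le_Mv from Literature.Probability.RandomPlanarGeometry.YangBaxterSAWGeneralDomain

namespace YBWalk

variable {D : Set Face} {a z : MidEdge} (γ : YBWalk D a z)

/-- An arc leaving through `N` is followed by an arc entering through `S` (private copy of the successor bookkeeping; the face version is
`fc_succ_eq_of_sOut_N`). [cite: GlazmanManolescu2019, §1, Fig. 1 (consecutive arcs lie in adjacent rhombi)] -/
private theorem sIn_succ_of_sOut_N' {i : ℕ} (hi : i + 1 < γ.arcs.length) (hN : γ.sOut i = .N) : γ.sIn (i + 1) = .S := by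
  obtain ⟨-, hout⟩ := γ.side_sIn_eq_nth (show i < γ.arcs.length by omega)
  obtain ⟨hin, -⟩ := γ.side_sIn_eq_nth hi
  rw [hN] at hout
  have e : (γ.fc (i + 1)).side (γ.sIn (i + 1)) = .slant (γ.fc i).1 ((γ.fc i).2 + 1) := by
    rw [hin, ← hout]; obtain ⟨k, j⟩ := γ.fc i; rfl
  rcases eq_of_side_eq_slant e with ⟨-, hs⟩ | ⟨h1, -⟩
  · exact hs
  · exfalso; refine γ.fc_succ_ne hi ?_
    rw [h1]; obtain ⟨k, j⟩ := γ.fc i; simp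

/-- An arc leaving through `S` is followed by an arc entering through `N` (private copy). [cite: GlazmanManolescu2019, §1, Fig. 1] -/
private theorem sIn_succ_of_sOut_S' {i : ℕ} (hi : i + 1 < γ.arcs.length) (hS : γ.sOut i = .S) : γ.sIn (i + 1) = .N := by
  obtain ⟨-, hout⟩ := γ.side_sIn_eq_nth (show i < γ.arcs.length by omega)
  obtain ⟨hin, -⟩ := γ.side_sIn_eq_nth hi
  rw [hS] at hout
  have e : (γ.fc (i + 1)).side (γ.sIn (i + 1)) = .slant (γ.fc i).1 (γ.fc i).2 := by
    rw [hin, ← hout]; obtain ⟨k, j⟩ := γ.fc i; rfl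
  rcases eq_of_side_eq_slant e with ⟨h1, -⟩ | ⟨-, hs⟩
  · exact absurd (h1.trans Prod.mk.eta).symm (γ.fc_succ_ne hi)
  · exact hs

/-- A straight arc entered from `N` leaves through `S`, one entered from `S` leaves through `N`, from `W` through `E`, from `E` through `W`.
[cite: GlazmanManolescu2019, §1, Fig. 1 (the straight arcs)] -/
theorem sOut_of_straight {i : ℕ} (hi : i < γ.arcs.length) (hk : arcKind (γ.sIn i) (γ.sOut i) = .straight) :
    γ.sOut i = (γ.sIn i).opp := by
  have hne := γ.sIn_ne_sOut hi
  revert hk hne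
  cases γ.sIn i <;> cases γ.sOut i <;> decide

end YBWalk

namespace ΩG

variable {D : Set Face} {w r : Face} {ω : ΩG D (w.side .W) r}

/-- ★ **NO MIDDLE ISOLATED TURN WITH A VERTICAL END**: for a wound class-`B2a` walk of limit cost `5` returning to a vertical side of `r`, no
isolated-turn plaquette lies strictly between the extreme rows `Y' < · < Y` of `turn_profile_of_cost_five` (all `4 = n_{u₁} + n_{u₂}` isolated
turns are the ends of the top and bottom runs). [cite: GlazmanManolescu2019, §1, Fig. 1 and eq. (1); Lemma 2.1; Remark 2.2] -/
theorem no_middle_isolated_turn_of_vertical_end (hh : holeFaceW w ∉ D) (hr : RootedFace D (w.side .W) r) (h : ω.IsB2a)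
    (hA : ω.AJ hr h (toC (midPt (w.side .W))) ≠ 0) (hc : cost (slotOfSide ω.1) ω.2.mids = 5) (hz : ω.1 = .W ∨ ω.1 = .E) :
    ∃ Y Y' : ℤ, Y' < w.2 ∧ w.2 < Y ∧ (∀ j < ω.2.arcs.length, (ω.2.fc j).2 ≤ Y) ∧ (∀ j < ω.2.arcs.length, Y' ≤ (ω.2.fc j).2) ∧
      (∀ i < ω.2.arcs.length, (∀ j < ω.2.arcs.length, ω.2.fc j = ω.2.fc i → j = i) →
        arcKind (ω.2.sIn i) (ω.2.sOut i) ≠ .straight → (ω.2.fc i).2 = Y ∨ (ω.2.fc i).2 = Y') ∧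
      (∀ f ∈ facesL ω.2.mids, (kindsL ω.2.mids f = [.corner] ∨ kindsL ω.2.mids f = [.coCorner]) → f.2 = Y ∨ f.2 = Y') := by
  classical
  obtain ⟨Y, Y', hY'w, hYw, hY, hY', hprof, -⟩ := turn_profile_of_cost_five hh hr h hA hc
  have hd : slotDeg (slotOfSide ω.1) = 0 := by rcases hz with e | e <;> rw [e] <;> rfl
  have hfaces : ∀ f ∈ facesL ω.2.mids, (kindsL ω.2.mids f = [.corner] ∨ kindsL ω.2.mids f = [.coCorner]) → f.2 = Y ∨ f.2 = Y' := by
    intro f hf hk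
    obtain ⟨m, hm, rfl⟩ := ω.2.exists_fc_eq_of_mem_facesL hf
    by_contra hne
    push Not at hne
    have hlt : Y' < (ω.2.fc m).2 ∧ (ω.2.fc m).2 < Y :=
      ⟨lt_of_le_of_ne (hY' m hm) (fun e => hne.2 e.symm), lt_of_le_of_ne (hY m hm) hne.1⟩
    have := (hprof {ω.2.fc m} (fun f hf' => by rw [Finset.mem_singleton.1 hf']; exact ⟨hf, hk⟩)).2.2
      (fun f hf' => by rw [Finset.mem_singleton.1 hf']; exact hlt)
    rw [Finset.card_singleton, hd] at this
    exact absurd this (by norm_num)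
  refine ⟨Y, Y', hY'w, hYw, hY, hY', fun i hi hsv hk => ?_, hfaces⟩
  obtain ⟨hmem, hkind⟩ := isolated_turn hi hsv hk
  exact hfaces _ hmem hkind

/-- ★ **STRAIGHT DESCENT OF A SINGLY VISITED COLUMN**: if the arc `i` lies in a singly visited column `X₀` at the top row `Y` and leaves through
`S`, no isolated-turn plaquette lies strictly between the rows `Y'` and `Y` (`Y' < Y`), and the walk returns to a vertical side of `r`, then the
arcs `i, i+1, …, i+(Y−Y')` run straight down the column: the arc `i + m` lies at `(X₀, Y − m)`, enters through `N` (`m ≥ 1`) and leaves through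
`S` (`m < Y − Y'`). [cite: GlazmanManolescu2019, §1, Fig. 1; Lemma 2.1] [cite: Glazman2015WeightedSAW, Lemma 3.1 (proof, pp. 6–7)] -/
theorem column_descent (hr : RootedFace D (w.side .W) r) (h : ω.IsB2a) (hz : ω.1 = .W ∨ ω.1 = .E) {X₀ Y Y' : ℤ} (hYY : Y' < Y)
    (hsv : ∀ i j, i < ω.2.arcs.length → j < ω.2.arcs.length → (ω.2.fc i).1 = X₀ → ω.2.fc i = ω.2.fc j → i = j)
    (hmid : ∀ i < ω.2.arcs.length, (∀ j < ω.2.arcs.length, ω.2.fc j = ω.2.fc i → j = i) →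
      arcKind (ω.2.sIn i) (ω.2.sOut i) ≠ .straight → (ω.2.fc i).2 = Y ∨ (ω.2.fc i).2 = Y')
    {i : ℕ} (hi : i < ω.2.arcs.length) (hcol : (ω.2.fc i).1 = X₀) (hrow : (ω.2.fc i).2 = Y) (hS : ω.2.sOut i = .S) :
    ∀ m : ℕ, (m : ℤ) ≤ Y - Y' → i + m < ω.2.arcs.length ∧ ω.2.fc (i + m) = (X₀, Y - m) ∧
      (1 ≤ m → ω.2.sIn (i + m) = .N) ∧ ((m : ℤ) < Y - Y' → ω.2.sOut (i + m) = .S)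
  | 0, _ => ⟨by simpa using hi, by rw [add_zero, ← hcol, ← hrow]; simp, fun h1 => absurd h1 (by norm_num), fun _ => by simpa using hS⟩
  | m + 1, hle => by
      obtain ⟨hlen, hfc, -, hout⟩ := column_descent hr h hz hYY hsv hmid hi hcol hrow hS m (by push_cast at hle ⊢; omega)
      have hSm : ω.2.sOut (i + m) = .S := hout (by push_cast at hle ⊢; omega)
      -- the arc `i + m` is not the last one: the last arc of a vertical-end walk leaves through `W` or `E`
      have hlast := (fc_last_of_end_vertical hr h hz).2.2
      have hlen' : i + m + 1 < ω.2.arcs.length := by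
        by_contra hge
        have e : i + m = ω.2.arcs.length - 1 := by omega
        rw [e] at hSm
        rcases hlast with h' | h' <;> rw [hSm] at h' <;> exact absurd h' (by decide)
      have hfc' := ω.2.fc_succ_eq_of_sOut_S hlen' hSm
      have hin' := ω.2.sIn_succ_of_sOut_S' hlen' hSm
      rw [hfc] at hfc'
      refine ⟨by rw [← add_assoc]; exact hlen', by rw [← add_assoc, hfc']; simp only; push_cast; ring_nf, fun _ => by
        rw [← add_assoc]; exact hin', fun hlt => ?_⟩
      -- strictly between the extreme rows the arc must be straight
      rw [← add_assoc]
      have hi' : i + m + 1 < ω.2.arcs.length := hlen'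
      have hcol' : (ω.2.fc (i + m + 1)).1 = X₀ := by rw [hfc']
      have hrow' : (ω.2.fc (i + m + 1)).2 = Y - (m + 1 : ℕ) := by rw [hfc']; simp only; push_cast; ring
      have hstr : arcKind (ω.2.sIn (i + m + 1)) (ω.2.sOut (i + m + 1)) = .straight := by
        by_contra hk
        have := hmid _ hi' (fun j hj he => hsv j _ hj hi' (by rw [he, hcol']) he) hk
        rw [hrow'] at this
        push_cast at this hlt
        omega
      have := ω.2.sOut_of_straight hi' hstr
      rw [hin'] at this
      exact this

/-- ★ **STRAIGHT ASCENT OF A SINGLY VISITED COLUMN** (the mirror statement: from the bottom row `Y'` leaving through `N` up to the top row).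
[cite: GlazmanManolescu2019, §1, Fig. 1; Lemma 2.1] [cite: Glazman2015WeightedSAW, Lemma 3.1 (proof, pp. 6–7)] -/
theorem column_ascent (hr : RootedFace D (w.side .W) r) (h : ω.IsB2a) (hz : ω.1 = .W ∨ ω.1 = .E) {X₀ Y Y' : ℤ} (hYY : Y' < Y)
    (hsv : ∀ i j, i < ω.2.arcs.length → j < ω.2.arcs.length → (ω.2.fc i).1 = X₀ → ω.2.fc i = ω.2.fc j → i = j)
    (hmid : ∀ i < ω.2.arcs.length, (∀ j < ω.2.arcs.length, ω.2.fc j = ω.2.fc i → j = i) →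
      arcKind (ω.2.sIn i) (ω.2.sOut i) ≠ .straight → (ω.2.fc i).2 = Y ∨ (ω.2.fc i).2 = Y')
    {i : ℕ} (hi : i < ω.2.arcs.length) (hcol : (ω.2.fc i).1 = X₀) (hrow : (ω.2.fc i).2 = Y') (hN : ω.2.sOut i = .N) :
    ∀ m : ℕ, (m : ℤ) ≤ Y - Y' → i + m < ω.2.arcs.length ∧ ω.2.fc (i + m) = (X₀, Y' + m) ∧
      (1 ≤ m → ω.2.sIn (i + m) = .S) ∧ ((m : ℤ) < Y - Y' → ω.2.sOut (i + m) = .N)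
  | 0, _ => ⟨by simpa using hi, by rw [add_zero, ← hcol, ← hrow]; simp, fun h1 => absurd h1 (by norm_num), fun _ => by simpa using hN⟩
  | m + 1, hle => by
      obtain ⟨hlen, hfc, -, hout⟩ := column_ascent hr h hz hYY hsv hmid hi hcol hrow hN m (by push_cast at hle ⊢; omega)
      have hNm : ω.2.sOut (i + m) = .N := hout (by push_cast at hle ⊢; omega)
      have hlast := (fc_last_of_end_vertical hr h hz).2.2
      have hlen' : i + m + 1 < ω.2.arcs.length := by
        by_contra hge
        have e : i + m = ω.2.arcs.length - 1 := by omega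
        rw [e] at hNm
        rcases hlast with h' | h' <;> rw [hNm] at h' <;> exact absurd h' (by decide)
      have hfc' := ω.2.fc_succ_eq_of_sOut_N hlen' hNm
      have hin' := ω.2.sIn_succ_of_sOut_N' hlen' hNm
      rw [hfc] at hfc'
      refine ⟨by rw [← add_assoc]; exact hlen', by rw [← add_assoc, hfc']; simp only; push_cast; ring_nf, fun _ => by
        rw [← add_assoc]; exact hin', fun hlt => ?_⟩
      rw [← add_assoc]
      have hi' : i + m + 1 < ω.2.arcs.length := hlen'
      have hcol' : (ω.2.fc (i + m + 1)).1 = X₀ := by rw [hfc']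
      have hrow' : (ω.2.fc (i + m + 1)).2 = Y' + (m + 1 : ℕ) := by rw [hfc']; simp only; push_cast; ring
      have hstr : arcKind (ω.2.sIn (i + m + 1)) (ω.2.sOut (i + m + 1)) = .straight := by
        by_contra hk
        have := hmid _ hi' (fun j hj he => hsv j _ hj hi' (by rw [he, hcol']) he) hk
        rw [hrow'] at this
        push_cast at this hlt
        omega
      have := ω.2.sOut_of_straight hi' hstr
      rw [hin'] at this
      exact this

/-- The columns of a westward run: `(fc (j₀ + k)).1 + k = (fc j₀).1` along a run of arcs in one row all leaving through `W`.
[cite: GlazmanManolescu2019, §1, Fig. 1 (consecutive arcs lie in adjacent rhombi)] -/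
theorem run_cols_W {j₀ i₁ : ℕ} (hi₁ : i₁ < ω.2.arcs.length) {Y : ℤ} (hrow : ∀ m, j₀ ≤ m → m ≤ i₁ → (ω.2.fc m).2 = Y)
    (hW : ∀ m, j₀ ≤ m → m < i₁ → ω.2.sOut m = .W) : ∀ k, j₀ + k ≤ i₁ → (ω.2.fc (j₀ + k)).1 + k = (ω.2.fc j₀).1
  | 0, _ => by simp
  | k + 1, hk => by
      have ih := run_cols_W hi₁ hrow hW k (by omega)
      have e := (ω.2.fc_succ_eq_of_sOut_W (show j₀ + k + 1 < ω.2.arcs.length by omega) (hW _ (by omega) (by omega))).1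
      rw [← add_assoc, e]; simp only; push_cast; omega

/-- The columns of an eastward run: `(fc (j₀ + k)).1 = (fc j₀).1 + k`. [cite: GlazmanManolescu2019, §1, Fig. 1] -/
theorem run_cols_E {j₀ i₁ : ℕ} (hi₁ : i₁ < ω.2.arcs.length) {Y : ℤ} (hrow : ∀ m, j₀ ≤ m → m ≤ i₁ → (ω.2.fc m).2 = Y)
    (hE : ∀ m, j₀ ≤ m → m < i₁ → ω.2.sOut m = .E) : ∀ k, j₀ + k ≤ i₁ → (ω.2.fc (j₀ + k)).1 = (ω.2.fc j₀).1 + k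
  | 0, _ => by simp
  | k + 1, hk => by
      have ih := run_cols_E hi₁ hrow hE k (by omega)
      have e := (ω.2.fc_succ_eq_of_sOut_E (show j₀ + k + 1 < ω.2.arcs.length by omega) (hE _ (by omega) (by omega))).1
      rw [← add_assoc, e]; simp only; push_cast; omega

/-- ★ **THE CORNERS OF THE LEFT COLUMN**: for a wound cost-`5` walk with a vertical end and extreme rows `Y' < Y`, the leftmost column `X`
carries isolated turns exactly at the two corners: `(X, Y)` and `(X, Y')` are visited isolated-turn plaquettes.
[cite: GlazmanManolescu2019, §1, Fig. 1 and eq. (1); Lemma 2.1] [cite: Glazman2015WeightedSAW, Lemma 3.1 (proof, pp. 6–7)] -/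
theorem left_corners_of_vertical_end (hh : holeFaceW w ∉ D) (hr : RootedFace D (w.side .W) r) (h : ω.IsB2a)
    (hA : ω.AJ hr h (toC (midPt (w.side .W))) ≠ 0) (hz : ω.1 = .W ∨ ω.1 = .E) {Y Y' : ℤ}
    (hfaces : ∀ f ∈ facesL ω.2.mids, (kindsL ω.2.mids f = [.corner] ∨ kindsL ω.2.mids f = [.coCorner]) → f.2 = Y ∨ f.2 = Y') :
    ∃ X : ℤ, X ≤ w.1 - 2 ∧ (∀ j < ω.2.arcs.length, X ≤ (ω.2.fc j).1) ∧ (X, Y) ∈ facesL ω.2.mids ∧ (X, Y') ∈ facesL ω.2.mids := by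
  classical
  obtain ⟨X, hXw, hX, T, hT, hTX, hcard⟩ := two_left_turns hh hr h hA
  have h2 : 2 ≤ T.card := by
    rcases hcard with h2 | ⟨-, hNS, -⟩
    · exact h2
    · rcases hz with e | e <;> rcases hNS with e' | e' <;> rw [e] at e' <;> exact absurd e' (by decide)
  refine ⟨X, hXw, hX, ?_⟩
  -- two distinct plaquettes of column `X` with rows in `{Y, Y'}`
  obtain ⟨f, hf, g, hg, hfg⟩ := Finset.one_lt_card.1 (by omega : 1 < T.card)
  have hfr := hfaces f (hT f hf).1 (hT f hf).2
  have hgr := hfaces g (hT g hg).1 (hT g hg).2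
  have hfx := hTX f hf
  have hgx := hTX g hg
  have hne : f.2 ≠ g.2 := fun e => hfg (Prod.ext (hfx.trans hgx.symm) e)
  have key : ∀ u : Face, u ∈ facesL ω.2.mids → u.1 = X → u.2 = Y → (X, Y) ∈ facesL ω.2.mids := by
    rintro ⟨u1, u2⟩ hu rfl rfl; exact hu
  have key' : ∀ u : Face, u ∈ facesL ω.2.mids → u.1 = X → u.2 = Y' → (X, Y') ∈ facesL ω.2.mids := by
    rintro ⟨u1, u2⟩ hu rfl rfl; exact hu
  rcases hfr with hfY | hfY' <;> rcases hgr with hgY | hgY'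
  · exact absurd (hfY.trans hgY.symm) hne
  · exact ⟨key f (hT f hf).1 hfx hfY, key' g (hT g hg).1 hgx hgY'⟩
  · exact ⟨key g (hT g hg).1 hgx hgY, key' f (hT f hf).1 hfx hfY'⟩
  · exact absurd (hfY'.trans hgY'.symm) hne

/-- ★ **THE CORNERS OF THE RIGHT COLUMN** (twin). [cite: GlazmanManolescu2019, §1, Fig. 1 and eq. (1); Lemma 2.1] -/
theorem right_corners_of_vertical_end (hh : holeFaceW w ∉ D) (hr : RootedFace D (w.side .W) r) (h : ω.IsB2a)
    (hz : ω.1 = .W ∨ ω.1 = .E) {Y Y' : ℤ}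
    (hfaces : ∀ f ∈ facesL ω.2.mids, (kindsL ω.2.mids f = [.corner] ∨ kindsL ω.2.mids f = [.coCorner]) → f.2 = Y ∨ f.2 = Y') :
    ∃ X : ℤ, w.1 ≤ X ∧ (∀ j < ω.2.arcs.length, (ω.2.fc j).1 ≤ X) ∧ (X, Y) ∈ facesL ω.2.mids ∧ (X, Y') ∈ facesL ω.2.mids := by
  classical
  obtain ⟨X, hXw, hX, T, hT, hTX, hcard⟩ := two_right_turns hh hr h
  have h2 : 2 ≤ T.card := by
    rcases hcard with h2 | ⟨-, hNS, -⟩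
    · exact h2
    · rcases hz with e | e <;> rcases hNS with e' | e' <;> rw [e] at e' <;> exact absurd e' (by decide)
  refine ⟨X, hXw, hX, ?_⟩
  obtain ⟨f, hf, g, hg, hfg⟩ := Finset.one_lt_card.1 (by omega : 1 < T.card)
  have hfr := hfaces f (hT f hf).1 (hT f hf).2
  have hgr := hfaces g (hT g hg).1 (hT g hg).2
  have hfx := hTX f hf
  have hgx := hTX g hg
  have hne : f.2 ≠ g.2 := fun e => hfg (Prod.ext (hfx.trans hgx.symm) e)
  have key : ∀ u : Face, u ∈ facesL ω.2.mids → u.1 = X → u.2 = Y → (X, Y) ∈ facesL ω.2.mids := by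
    rintro ⟨u1, u2⟩ hu rfl rfl; exact hu
  have key' : ∀ u : Face, u ∈ facesL ω.2.mids → u.1 = X → u.2 = Y' → (X, Y') ∈ facesL ω.2.mids := by
    rintro ⟨u1, u2⟩ hu rfl rfl; exact hu
  rcases hfr with hfY | hfY' <;> rcases hgr with hgY | hgY'
  · exact absurd (hfY.trans hgY.symm) hne
  · exact ⟨key f (hT f hf).1 hfx hfY, key' g (hT g hg).1 hgx hgY'⟩
  · exact ⟨key g (hT g hg).1 hgx hgY, key' f (hT f hf).1 hfx hfY'⟩
  · exact absurd (hfY'.trans hgY'.symm) hne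

/-- ★★★ **NO VERTICAL END AT LIMIT COST `5`.** A wound class-`B2a` walk of limit cost `5` from the hole root `w.side W` (hole `(w.1 − 1, w.2)`
absent) returns to the `N` or the `S` side of `r` — never to a vertical side. (Frame argument: with a vertical end the four corners
`(X,Y)`, `(X,Y')`, `(X',Y)`, `(X',Y')` are the only isolated turns, the extreme columns run straight between them, and the top run, a column,
the bottom run and the other column would close into a cycle in the arc order.) [cite: GlazmanManolescu2019, §1, Fig. 1 and eq. (1); Lemma 2.1; Remark 2.2]
[cite: Glazman2015WeightedSAW, Lemma 3.1 (proof, pp. 6–7)] -/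
theorem end_slanted_of_cost_five (hh : holeFaceW w ∉ D) (hr : RootedFace D (w.side .W) r) (h : ω.IsB2a)
    (hA : ω.AJ hr h (toC (midPt (w.side .W))) ≠ 0) (hc : cost (slotOfSide ω.1) ω.2.mids = 5) : ω.1 = .N ∨ ω.1 = .S := by
  classical
  by_contra hns
  have hz : ω.1 = .W ∨ ω.1 = .E := by
    revert hns; cases ω.1 <;> simp
  obtain ⟨Y, Y', hY'w, hYw, hY, hY', hmid, hfaces⟩ := no_middle_isolated_turn_of_vertical_end hh hr h hA hc hz
  have hYY : Y' < Y := by omega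
  obtain ⟨X, hXw, hX, hXY, hXY'⟩ := left_corners_of_vertical_end hh hr h hA hz hfaces
  obtain ⟨X', hX'w, hX', hX'Y, hX'Y'⟩ := right_corners_of_vertical_end hh hr h hz hfaces
  have hXX : X < X' := by omega
  -- single visits of the extreme columns
  have hsvL : ∀ i j, i < ω.2.arcs.length → j < ω.2.arcs.length → (ω.2.fc i).1 = X → ω.2.fc i = ω.2.fc j → i = j :=
    fun i j hi hj hcol he => left_single_visit hh hr h hX (by omega) hi hj hcol he
  have hsvR : ∀ i j, i < ω.2.arcs.length → j < ω.2.arcs.length → (ω.2.fc i).1 = X' → ω.2.fc i = ω.2.fc j → i = j :=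
    fun i j hi hj hcol he => right_single_visit hh hr h hX' hi hj hcol he
  -- the top run and the bottom run
  obtain ⟨Yt, -, hYt, j₀, i₁, hj₀1, hji, hi₁, hrowT, hinT, -, houtT, hinT', hstrT, hmarchT⟩ :=
    top_run_shape hh hr h hA (by omega)
  obtain ⟨Yb, -, hYb, j₀', i₁', hj₀1', hji', hi₁', hrowB, hinB, -, houtB, hinB', hstrB, hmarchB⟩ :=
    bottom_run_shape hh hr h hA (by omega)
  -- identify the extreme rows
  obtain ⟨mt, hmt, hfmt⟩ := ω.2.exists_fc_eq_of_mem_facesL hXY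
  obtain ⟨mb, hmb, hfmb⟩ := ω.2.exists_fc_eq_of_mem_facesL hXY'
  have eYt : Yt = Y := le_antisymm (by have := hY j₀ (by omega); rw [(hrowT j₀ (by omega)).2 ⟨le_rfl, hji.le⟩] at this; exact this)
    (by have := hYt mt hmt; rw [hfmt] at this; exact this)
  have eYb : Yb = Y' := le_antisymm (by have := hYb mb hmb; rw [hfmb] at this; exact this)
    (by have := hY' j₀' (by omega); rw [(hrowB j₀' (by omega)).2 ⟨le_rfl, hji'.le⟩] at this; exact this)
  subst eYt; subst eYb
  -- rows along the runs
  have hrowT' : ∀ m, j₀ ≤ m → m ≤ i₁ → (ω.2.fc m).2 = Yt := fun m h1 h2 => (hrowT m (by omega)).2 ⟨h1, h2⟩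
  have hrowB' : ∀ m, j₀' ≤ m → m ≤ i₁' → (ω.2.fc m).2 = Yb := fun m h1 h2 => (hrowB m (by omega)).2 ⟨h1, h2⟩
  -- in the top row only `j₀` enters vertically; in the bottom row only `j₀'`
  have honlyT : ∀ m < ω.2.arcs.length, (ω.2.fc m).2 = Yt → ω.2.sIn m = .S → m = j₀ := by
    intro m hm hrow hS
    obtain ⟨h1, h2⟩ := (hrowT m hm).1 hrow
    by_contra hne
    rcases lt_or_eq_of_le h2 with hlt | rfl
    · have hk := hstrT m (by omega) hlt
      rw [hS] at hk
      rcases hmarchT with ⟨hWall, -⟩ | ⟨hEall, -⟩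
      · rw [hWall m h1 hlt] at hk; exact absurd hk (by decide)
      · rw [hEall m h1 hlt] at hk; exact absurd hk (by decide)
    · rcases hinT' with e | e <;> rw [hS] at e <;> exact absurd e (by decide)
  have honlyB : ∀ m < ω.2.arcs.length, (ω.2.fc m).2 = Yb → ω.2.sIn m = .N → m = j₀' := by
    intro m hm hrow hN
    obtain ⟨h1, h2⟩ := (hrowB m hm).1 hrow
    by_contra hne
    rcases lt_or_eq_of_le h2 with hlt | rfl
    · have hk := hstrB m (by omega) hlt
      rw [hN] at hk
      rcases hmarchB with ⟨hWall, -⟩ | ⟨hEall, -⟩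
      · rw [hWall m h1 hlt] at hk; exact absurd hk (by decide)
      · rw [hEall m h1 hlt] at hk; exact absurd hk (by decide)
    · rcases hinB' with e | e <;> rw [hN] at e <;> exact absurd e (by decide)
  -- the extreme columns of the top run are `X` (at `mt`) and `X'`
  obtain ⟨mt', hmt', hfmt'⟩ := ω.2.exists_fc_eq_of_mem_facesL hX'Y
  obtain ⟨hmt1, hmt2⟩ := (hrowT mt hmt).1 (by rw [hfmt])
  obtain ⟨hmt1', hmt2'⟩ := (hrowT mt' hmt').1 (by rw [hfmt'])
  obtain ⟨mb', hmb', hfmb'⟩ := ω.2.exists_fc_eq_of_mem_facesL hX'Y'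
  obtain ⟨hmb1, hmb2⟩ := (hrowB mb hmb).1 (by rw [hfmb])
  obtain ⟨hmb1', hmb2'⟩ := (hrowB mb' hmb').1 (by rw [hfmb'])
  set d : ℕ := (Yt - Yb).toNat with hd
  have hdZ : (d : ℤ) = Yt - Yb := by rw [hd]; exact Int.toNat_of_nonneg (by omega)
  rcases hmarchT with ⟨hWall, hlenT⟩ | ⟨hEall, hlenT⟩
  · -- the top run marches WEST: it ends at the corner `(X, Yt)`, leaving through `S`
    have hcolsT := run_cols_W hi₁ hrowT' hWall
    have hci₁ : (ω.2.fc i₁).1 = X := by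
      have e1 := hcolsT (mt - j₀) (by omega)
      rw [show j₀ + (mt - j₀) = mt by omega, hfmt] at e1
      have e2 := hcolsT (i₁ - j₀) (by omega)
      rw [show j₀ + (i₁ - j₀) = i₁ by omega] at e2
      have := hX i₁ hi₁
      simp only at e1; omega
    -- descend the left column from `i₁`
    obtain ⟨hlen1, hfc1, hin1, -⟩ := column_descent hr h hz hYY hsvL hmid hi₁ hci₁ (hrowT' i₁ hji.le le_rfl) houtT d hdZ.le
    have hj₀' : i₁ + d = j₀' := honlyB _ hlen1 (by rw [hfc1]; simp only; omega) (hin1 (by omega))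
    -- the bottom run starts at `(X, Yb)`, so it marches EAST and ends at `(X', Yb)` leaving through `N`
    have hcj₀' : (ω.2.fc j₀').1 = X := by rw [← hj₀', hfc1]
    rcases hmarchB with ⟨hWallB, hlenB⟩ | ⟨hEallB, hlenB⟩
    · -- westward from `X` would leave the frame
      exfalso
      have := hX i₁' hi₁'
      omega
    · have hci₁' : (ω.2.fc i₁').1 = X' := by
        have hcolsB := run_cols_E hi₁' hrowB' hEallB
        have e1 := hcolsB (mb' - j₀') (by omega)
        rw [show j₀' + (mb' - j₀') = mb' by omega, hfmb'] at e1
        have e2 := hcolsB (i₁' - j₀') (by omega)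
        rw [show j₀' + (i₁' - j₀') = i₁' by omega] at e2
        have := hX' i₁' hi₁'
        simp only at e1; omega
      obtain ⟨hlen2, hfc2, hin2, -⟩ := column_ascent hr h hz hYY hsvR hmid hi₁' hci₁' (hrowB' i₁' hji'.le le_rfl) houtB d hdZ.le
      have hj₀ : i₁' + d = j₀ := honlyT _ hlen2 (by rw [hfc2]; simp only; omega) (hin2 (by omega))
      omega
  · -- the top run marches EAST: it ends at the corner `(X', Yt)`, leaving through `S`
    have hcolsT := run_cols_E hi₁ hrowT' hEall
    have hci₁ : (ω.2.fc i₁).1 = X' := by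
      have e1 := hcolsT (mt' - j₀) (by omega)
      rw [show j₀ + (mt' - j₀) = mt' by omega, hfmt'] at e1
      have e2 := hcolsT (i₁ - j₀) (by omega)
      rw [show j₀ + (i₁ - j₀) = i₁ by omega] at e2
      have := hX' i₁ hi₁
      simp only at e1; omega
    obtain ⟨hlen1, hfc1, hin1, -⟩ := column_descent hr h hz hYY hsvR hmid hi₁ hci₁ (hrowT' i₁ hji.le le_rfl) houtT d hdZ.le
    have hj₀' : i₁ + d = j₀' := honlyB _ hlen1 (by rw [hfc1]; simp only; omega) (hin1 (by omega))
    have hcj₀' : (ω.2.fc j₀').1 = X' := by rw [← hj₀', hfc1]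
    rcases hmarchB with ⟨hWallB, hlenB⟩ | ⟨hEallB, hlenB⟩
    · have hci₁' : (ω.2.fc i₁').1 = X := by
        have hcolsB := run_cols_W hi₁' hrowB' hWallB
        have e1 := hcolsB (mb - j₀') (by omega)
        rw [show j₀' + (mb - j₀') = mb by omega, hfmb] at e1
        have e2 := hcolsB (i₁' - j₀') (by omega)
        rw [show j₀' + (i₁' - j₀') = i₁' by omega] at e2
        have := hX i₁' hi₁'
        simp only at e1; omega
      obtain ⟨hlen2, hfc2, hin2, -⟩ := column_ascent hr h hz hYY hsvL hmid hi₁' hci₁' (hrowB' i₁' hji'.le le_rfl) houtB d hdZ.le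
      have hj₀ : i₁' + d = j₀ := honlyT _ hlen2 (by rw [hfc2]; simp only; omega) (hin2 (by omega))
      omega
    · -- eastward from `X'` would leave the frame
      exfalso
      have := hX' i₁' hi₁'
      omega

/-- ★★ **FIVE ISOLATED TURNS**: a wound class-`B2a` walk of limit cost `5` from the hole root has `n_{u₁} + n_{u₂} = 5` (slanted end, slot degree
`1`). [cite: GlazmanManolescu2019, §1, Fig. 1 and eq. (1); Lemma 2.1; Remark 2.2] -/
theorem isolated_eq_five_of_cost_five (hh : holeFaceW w ∉ D) (hr : RootedFace D (w.side .W) r) (h : ω.IsB2a)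
    (hA : ω.AJ hr h (toC (midPt (w.side .W))) ≠ 0) (hc : cost (slotOfSide ω.1) ω.2.mids = 5) :
    cfgCount ω.2.mids [.corner] + cfgCount ω.2.mids [.coCorner] = 5 ∧ slotDeg (slotOfSide ω.1) = 1 := by
  have hz := end_slanted_of_cost_five hh hr h hA hc
  have hd : slotDeg (slotOfSide ω.1) = 1 := by rcases hz with e | e <;> rw [e] <;> rfl
  refine ⟨?_, hd⟩
  unfold cost at hc; rw [hd] at hc; omega

end ΩG

end Literature.Probability.RandomPlanarGeometry.SAW.YangBaxter
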